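import Summits.HodgeConjecture.HodgeConjecture.Theorems.F0P6aSpecialSheetPointCMHom                 -- ★ p850956 (B3-SRC) `exists_cmConjHom_at_specialSheetPoint` (brings ★ #42 p850866, ★ (R-CM) p850737, σ1-UNPACK)
import Literature.AlgebraicGeometry.ShimuraVarieties.UnitaryShimuraCurveSpecialSheetPointTwist           -- ★ p850898 (LA4-p04 (g4)) `hpt`: `RecordSystemGS.thickeningLift_left_comp_gal_eq_specTwist_comp_of_recip'`
import Literature.AlgebraicGeometry.ShimuraVarieties.UnitaryCurveAuxiliaryTorusLegLiftPrincipal          -- ★ p850830 (LA5-p02 (g4)) #41 letters `exists_isLambdaOfAt_symplecticLift_torusLeg_principal`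
import Literature.AlgebraicGeometry.AbelianSchemes.SerreTwistPolarization                               -- ★ `IsExactTwistPol`, `isExactTwistPol_iff`
import Literature.AlgebraicGeometry.ShimuraVarieties.UnitaryShimuraCurveRecordMorphisms                 -- ★ `RecordSystemGS.HeckeTranslateDefinedOver` (the letter՚s (U7ₛ) binder)
import Literature.NumberTheory.NumberFields.IdealClassCoprimeRepresentative                             -- ★ `pointwise_smul_ne_bot` (`n ≠ 0` from rows (a)(c))
import Literature.NumberTheory.GaloisRepresentations.HeckeCharacterOfRayClass                            -- ★ `modulusExp` (the congruence `z ≡ 1 mod N`)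
import HarnessLib

/-!
# `organB3Src_holds` — THE (B3) SOURCE PACKAGE `OrganB3Src` PAID (LEG-E(γ′) glue, socket (B3) = (R-CM) «the tuple iso intertwines the actions»)
# ([Shimura 1998] §18.6; [Milne 2005] Def. 12.8, Thm. 13.6, §14 Prop. 14.12; RSZ §3.2)

Cell `hodgecm-mathlib` (D-0151), FLOOR 0, P6 «MOD programme», crux hLiu418 (stmt-HodgeConjecture-24832, `--supports`, count-neutral), line «L4».  LA6-p02 (g3)՚s
(B3) frame `F0/P6/L6/LA6-p02/g3/F0P6aOrganB3.frame.v1.LA6-p02g3.lean` 5763cbfc proves `organB3_of_src : OrganB3Src → OrganB3` (one call of ★ p850815 per special sheet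
point); THIS FILE PAYS ITS ONE HYPOTHESIS: **`organB3Src_holds : <def OrganB3Src body VERBATIM>`** (frame :137–:218), with the junction `IsSheetTwistOf ι₁ τE Φ hΦ C.N γ₁ 𝔞 n`
UNFOLDED into its rows (a)(b)(c) and witnesses `(γ̃, sE, z)` (`twistType ι₁ Φ hΦ` spelled `flip ι₁ (bar Φ)`; the two texts agree by `delta`, so
`theorem organB3Src : OrganB3Src := organB3Src_holds` in the frame՚s namespace).  Proof = assembly of three ★ organs at each special sheet point `z₀ = pts⁻¹[ι₁w, a]`:
★ p850956 (B3-SRC) `exists_cmConjHom_at_specialSheetPoint` (σ, `s := ℓ_{eE}(pts⁻¹[ι₁w, d⁻¹a])`, σ1՚s `(m₁, Θ₁, Λ₁)` at `s`, #42՚s eight names at `ℓ_{eE} z₀`, the CM hom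
`(f, k, hf, hint)`), ★ p850898 `hpt` (LA4-p04), ★ p850830 the tower `(Θ₂, hΘ₂, Λ₂, hΛ₂)` through `r₂⁻¹` (LA5-p02; its (t3) input is `IsExactTwistPol`, (surj) from ★
`serreCover_rows_of_presentation`, `z z̄ = q` from `z ∈ T(𝔸_f)`, the frame reading from the pin).
HONEST LABEL: HC_CM is proved only modulo the 7 printed citations (2 remaining: hLiu418 24832, h413 24833) until rung 0 closes; this file closes no statement item.

## References
* [Shimura1998] G. Shimura, *Abelian Varieties with Complex Multiplication and Modular Functions* (1998), §18.6 pp. 124–128.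
* [Milne2005ShimuraVarieties] J. S. Milne, *Introduction to Shimura varieties* (2005), Def. 12.8 p. 114, Thm. 13.6 p. 118, §14 Prop. 14.12 p. 125.
* [RapoportSmithlingZhang2020Diagonal] M. Rapoport, B. Smithling, W. Zhang (2020), §3.2 p. 11.
-/

set_option autoImplicit false

noncomputable section

namespace Summit.HodgeConjecture.HodgeConjecture.Theorems.F0P6aOrganB3Src

set_option linter.dupNamespace false  -- `Summit.HodgeConjecture.HodgeConjecture.…` BY DESIGN (D-0017)

open CategoryTheory CategoryTheory.Limits NumberField IsDedekindDomain MulAction AlgebraicGeometry Topology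
open scoped Matrix Polynomial Pointwise nonZeroDivisors MonObj
open Literature.NumberTheory.GaloisRepresentations
open Literature.NumberTheory.Automorphic Literature.NumberTheory.Automorphic.UnitaryGroup
open Literature.AlgebraicGeometry.ShimuraVarieties Literature.AlgebraicGeometry.ShimuraVarieties.UnitaryCanonicalModel
open Literature.NumberTheory.Automorphic.Liu2021.AppendixC
open Literature.AlgebraicGeometry.Motives (AlgPoints ComplexPoints SchemeOver thickeningLift specOver CartierDivisor CMType AbelianVariety)
open Literature.AlgebraicGeometry.Motives.AbelianVariety (bcSpec)
open Literature.AlgebraicGeometry.AbelianSchemes (PolarizedAbelianSchemeWithLevel AbelianSchemeOver)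
open Literature.AlgebraicGeometry.ModuliOfAbelianVarieties
open Summit.HodgeConjecture.HodgeConjecture.Cruxes.HLiu418.F0P6aPELWitnessE
open Summit.HodgeConjecture.HodgeConjecture.Cruxes.HLiu418.F0P6aStubE6 (RingActionReading)
open Summit.HodgeConjecture.HodgeConjecture.Cruxes.HLiu418.F0P6aChartFramePin (IsChartOfFrame)
open Literature.AlgebraicGeometry.ShimuraVarieties.UnitaryCanonicalModel.Aux (ratBasis torusFinAdelic reflexField numberField_reflexField)
open Literature.AlgebraicGeometry.ShimuraVarieties.UnitaryCurve Literature.AlgebraicGeometry.ShimuraVarieties.UnitaryCurve.AuxV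
open Literature.NumberTheory.ComplexMultiplication (reflexNormFiniteIdele)
open Literature.NumberTheory.ComplexMultiplication.CMTypeOps (flip bar)
open Summit.HodgeConjecture.HodgeConjecture.Theorems.F0P6aSpecialSheetPointCMHom (exists_cmConjHom_at_specialSheetPoint)

set_option maxHeartbeats 800000 in -- the statement is the (B3) frame՚s socket text (≈ 80 lines, 24 existential binders); the proof is assembly of three ★ organs
/-- **`organB3Src_holds` — THE (B3) SOURCE PACKAGE, PAID.**  For every special sheet point `ℓ_{eE}(z₀)`, `z₀ = pts⁻¹[ι₁w, a]`, of `X = M_{Kc} ⊗_F Fᵢ` along the sheet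
`eE = τE`, and every junction datum `(γ₁, 𝔞, n; γ̃, sE, z)`: the Galois element `σ = γ̃`, the SOURCE point `s = ℓ_{eE}(pts⁻¹[ι₁w, d⁻¹a])` with
`ℓ_{eE}(z₀) ≫ (1 × Spec γ₁⁻¹) = Spec σ ≫ s`, σ1՚s CM datum `(m₁, Θ₁, Λ₁)` at `s`, the Serre-tensor fibre at `ℓ_{eE}(z₀)` marked at a principal Siegel representative
`(Z, r ∈ K_δ(1), m₂)` with its admissibility tower `(Θ₂, Λ₂)` read through `r⁻¹`, and the CM homomorphism `f : (P_s)^σ ⟶ B_{ℓ_{eE}(z₀)}` with its `K_δ(N)`-twisted torsion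
reading and its intertwining of `ρ` and `serreAction` — the `OrganB3Src` letter of the (B3) frame, verbatim.
[cite: Shimura1998, §18.6 pp. 124–128] [cite: Milne2005ShimuraVarieties, Def. 12.8 p. 114, Thm. 13.6 p. 118, §14 Prop. 14.12 p. 125] [cite: RapoportSmithlingZhang2020Diagonal, §3.2 p. 11] -/
theorem organB3Src_holds :
  ∀ (F : Type) [Field F] [NumberField F] [IsCMField F] [IsGalois ℚ F] (ι₁ : F →+* ℂ)
    (Jstar : Matrix (Fin 2) (Fin 2) F) (_hJ : (Jstar.map (IsCMField.complexConj F))ᵀ = Jstar) (_hJu : IsUnit Jstar)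
    (K₀ : C5.OpenCompactSubgroup (GSAdele F Jstar)) (S : RecordSystemGS F Jstar ι₁ K₀) (_hU7ₛ : S.HeckeTranslateDefinedOver) (Kc : C5.SmallLevel K₀)
    (Fi : Type) [Field Fi] [NumberField Fi] [Algebra F Fi] [IsGalois F Fi] (τE : Fi →+* ℂ) (_hτE : τE.comp (algebraMap F Fi) = ι₁)
    (Φ : Set (F →+* ℂ)) (hΦ : IsCMTypeThrough ι₁ Φ) (C : AuxChartGS F ι₁ Jstar K₀ S Kc Fi τE Φ)
    (ξ : F) (k : ℕ) (Fr : SymplecticFrameV F (RingHom.id F) Jstar ((k : ℚ) • ξ) C.g C.δ) (_hpin : IsChartOfFrame hΦ C ξ k Fr)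
    (ε : (Literature.AlgebraicGeometry.Motives.baseChange F Fi).obj (S.M.obj Kc) ⟶
        (Literature.AlgebraicGeometry.Motives.baseChange ℚ Fi).obj C.𝓜.M)
    (_hε : letI : Algebra Fi ℂ := τE.toAlgebra
      ∀ (P : ComplexPoints ((Literature.AlgebraicGeometry.Motives.baseChange F Fi).obj (S.M.obj Kc)))
        (Pflat : letI : Algebra F ℂ := ι₁.toAlgebra; ComplexPoints (S.M.obj Kc)),
        Pflat.left = P.left ≫ pullback.fst (S.M.obj Kc).hom (bcSpec F Fi) →
        (AlgPoints.map ε P).left ≫ pullback.fst C.𝓜.M.hom (bcSpec ℚ Fi) =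
          (letI : Algebra F ℂ := ι₁.toAlgebra; (C.f (S.pts Kc Pflat)).left))
    (ρ : AbelianSchemeOver.RingAction (𝓞 F) (C.𝓜.univ.baseChange (ε.left ≫ pullback.fst C.𝓜.M.hom (bcSpec ℚ Fi))).A),
    RingActionReading C ε ρ →
    ∀ (γ₁ : Fi ≃ₐ[F] Fi) (𝔞 : Ideal (𝓞 F)) (n : ℕ),
      -- `IsSheetTwistOf ι₁ τE Φ hΦ C.N γ₁ 𝔞 n` UNFOLDED (its `def` lives in the Lines closer ∕ the (B3) frame; `twistType ι₁ Φ hΦ := flip ι₁ (bar Φ)`)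
      (Ideal.span {((n : ℕ) : 𝓞 F)} = 𝔞 * (IsCMField.complexConj F) • 𝔞 ∧
        𝔞 ⊔ Ideal.span {((C.N : ℕ) : 𝓞 F)} = ⊤ ∧ 𝔞 ≠ ⊥ ∧
        haveI : NumberField ↥(reflexField F (flip ι₁ (bar (⟨Φ, hΦ.2⟩ : CMType F))) ι₁) :=
          numberField_reflexField F (flip ι₁ (bar (⟨Φ, hΦ.2⟩ : CMType F))) ι₁
        ∃ (γ' : ℂ ≃+* ℂ)
          (sE : (FiniteAdeleRing (𝓞 ↥(reflexField F (flip ι₁ (bar (⟨Φ, hΦ.2⟩ : CMType F))) ι₁))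
            ↥(reflexField F (flip ι₁ (bar (⟨Φ, hΦ.2⟩ : CMType F))) ι₁))ˣ)
          (z : (FiniteAdeleRing (𝓞 F) F)ˣ),
          (∀ x : Fi, γ' (τE x) = τE (γ₁ x)) ∧ (∀ x : F, γ' (ι₁ x) = ι₁ x) ∧
          IsArtinCorrespondent ↥(reflexField F (flip ι₁ (bar (⟨Φ, hΦ.2⟩ : CMType F))) ι₁)
            (algebraMap ↥(reflexField F (flip ι₁ (bar (⟨Φ, hΦ.2⟩ : CMType F))) ι₁) ℂ) sE γ' ∧
          z = reflexNormFiniteIdele F (flip ι₁ (bar (⟨Φ, hΦ.2⟩ : CMType F)))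
            (reflexField F (flip ι₁ (bar (⟨Φ, hΦ.2⟩ : CMType F))) ι₁) sE ∧
          FiniteAdeleRing.toFractionalIdeal (𝓞 F) F z = ((𝔞 : FractionalIdeal (𝓞 F)⁰ F))⁻¹ ∧
          ∀ v : HeightOneSpectrum (𝓞 F), Ideal.span {((C.N : ℕ) : 𝓞 F)} ≤ v.asIdeal →
            Valued.v ((z : FiniteAdeleRing (𝓞 F) F) v) = 1 ∧
            Valued.v ((z : FiniteAdeleRing (𝓞 F) F) v - 1) ≤ WithZero.exp (-(modulusExp (Ideal.span {((C.N : ℕ) : 𝓞 F)}) v : ℤ))) →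
      letI P := C.𝓜.univ.baseChange (ε.left ≫ pullback.fst C.𝓜.M.hom (bcSpec ℚ Fi))
      letI X := (Literature.AlgebraicGeometry.Motives.baseChange F Fi).obj (S.M.obj Kc)
      letI gγ : X.left ⟶ X.left := Literature.AlgebraicGeometry.Motives.GaloisDescent.gal Fi (S.M.obj Kc) γ₁⁻¹
      letI : Algebra F ℂ := ι₁.toAlgebra
  ∀ [IsCommMonObj P.A.X] (m : ℕ) (E' : Matrix (Fin m) (Fin m) (𝓞 F)) (hE' : E' * E' = E') (Pm : Matrix (Fin m) (Fin 1) (𝓞 F))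
    (Qm : Matrix (Fin 1) (Fin m) (𝓞 F)),
    E' * Pm = Pm → Qm * E' = Qm → Qm * Pm = Matrix.scalar (Fin 1) ((n : ℕ) : 𝓞 F) → Pm * Qm = Matrix.scalar (Fin m) ((n : ℕ) : 𝓞 F) * E' →
    Ideal.span (Set.range fun j => Pm j 0) = 𝔞 →
    ∀ (Db : (AbelianSchemeOver.serreTensor ρ E' hE').DualPair)
      (_hDb : Nonempty ((Scheme.Modules.pullback (AbelianSchemeOver.DualPair.unitHatSlice Db)).obj Db.P ≅ SheafOfModules.unit _))
      (polB : (AbelianSchemeOver.serreTensor ρ E' hE').Polarization Db)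
      (lvl' : (AbelianSchemeOver.serreTensor ρ E' hE').LevelStructure C.g C.N),
      AbelianSchemeOver.IsExactTwistPol ρ E' hE' Pm P.D Db P.pol n polB.lam →
      (∀ i, lvl'.σ i = P.level.σ i ≫ AbelianSchemeOver.serreTranslate ρ E' hE' Pm) →
      ∀ (eE : Fi →ₐ[F] ℂ), (∀ x, eE x = τE x) →
        ∀ (w : Fin 2 → F) (hw : (fun i => ι₁ (w i)) ∈ negCone (Jstar.map ι₁)) (a : GSAdele F Jstar),
          ∃ (σ : ℂ ≃ₐ[ℚ] ℂ) (s : Spec (.of ℂ) ⟶ X.left)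
            (_hpt : (thickeningLift eE (S.M.obj Kc)
                ((S.pts Kc).symm (ShimuraSetGS.mk F Jstar ι₁ Kc.1.1 (fun i => ι₁ (w i)) hw a))).left ≫ gγ =
              AbelianSchemeOver.specTwist σ.toRingEquiv ≫ s)
            (J : C0pm C.δ) (a₁ k : ↥(gspFinAdelic C.δ))
            (Θ₁ : CartierDivisor (P.A.fibre s).toAbelianVariety.X.left) (_h₁ : P.A.IsLambdaOfAt s P.D P.pol.lam Θ₁)
            (Λ₁ : P.level.SymplecticLift s Θ₁ C.δ) (m₁ : SiegelAdelicMarking J a₁ (P.A.fibre s).toAbelianVariety)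
            (_hΛ₁ : ∀ ⦃M : ℕ⦄, C.N ∣ M → M ≠ 0 → ∀ (x : Fin C.g ⊕ Fin C.g → ZMod M) (v : Fin C.g ⊕ Fin C.g → ℚ),
              AdelicCongr ((a₁⁻¹ : gspFinAdelic C.δ) : GL (Fin C.g ⊕ Fin C.g) finAdeleQ) 1 v (fun i => ((x i).val : ℚ) / M) →
                ((Λ₁.lift M (Multiplicative.ofAdd x)) : (P.A.fibre s).toAbelianVariety.Points ℂ) = m₁.r v)
            (r : ↥(gspFinAdelic C.δ)) (_hr : r ∈ principalLevelSubgroup C.δ 1)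
            (Z : Matrix (Fin C.g) (Fin C.g) ℂ) (hZ : Z ∈ siegelUpperHalfSpace C.g)
            (m₂ : SiegelAdelicMarking ⟨SiegelModuli.jOfSiegel C.δ Z, SiegelComplexRecordSystem.jOfSiegel_mem_C0pm C.hδ.1 hZ⟩ r
              ((AbelianSchemeOver.serreTensor ρ E' hE').fibre (thickeningLift eE (S.M.obj Kc)
                ((S.pts Kc).symm (ShimuraSetGS.mk F Jstar ι₁ Kc.1.1 (fun i => ι₁ (w i)) hw a))).left).toAbelianVariety)
            (Θ₂ : CartierDivisor ((AbelianSchemeOver.serreTensor ρ E' hE').fibre (thickeningLift eE (S.M.obj Kc)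
                ((S.pts Kc).symm (ShimuraSetGS.mk F Jstar ι₁ Kc.1.1 (fun i => ι₁ (w i)) hw a))).left).toAbelianVariety.X.left)
            (_hΘ₂ : (AbelianSchemeOver.serreTensor ρ E' hE').IsLambdaOfAt (thickeningLift eE (S.M.obj Kc)
                ((S.pts Kc).symm (ShimuraSetGS.mk F Jstar ι₁ Kc.1.1 (fun i => ι₁ (w i)) hw a))).left Db polB.lam Θ₂)
            (Λ₂ : lvl'.SymplecticLift (thickeningLift eE (S.M.obj Kc)
                ((S.pts Kc).symm (ShimuraSetGS.mk F Jstar ι₁ Kc.1.1 (fun i => ι₁ (w i)) hw a))).left Θ₂ C.δ)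
            (_hΛ₂ : ∀ ⦃M : ℕ⦄, C.N ∣ M → M ≠ 0 → ∀ (x : Fin C.g ⊕ Fin C.g → ZMod M) (v : Fin C.g ⊕ Fin C.g → ℚ),
              AdelicCongr ((r⁻¹ : gspFinAdelic C.δ) : GL (Fin C.g ⊕ Fin C.g) finAdeleQ) 1 v (fun i => ((x i).val : ℚ) / M) →
                ((Λ₂.lift M (Multiplicative.ofAdd x)) : ((AbelianSchemeOver.serreTensor ρ E' hE').fibre
                  (thickeningLift eE (S.M.obj Kc)
                    ((S.pts Kc).symm (ShimuraSetGS.mk F Jstar ι₁ Kc.1.1 (fun i => ι₁ (w i)) hw a))).left).toAbelianVariety.Points ℂ) =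
                  m₂.r v)
            (f : ((P.A.fibre s).toAbelianVariety).conjugate σ.toRingEquiv ⟶
              ((AbelianSchemeOver.serreTensor ρ E' hE').fibre (thickeningLift eE (S.M.obj Kc)
                ((S.pts Kc).symm (ShimuraSetGS.mk F Jstar ι₁ Kc.1.1 (fun i => ι₁ (w i)) hw a))).left).toAbelianVariety)
            (_hk : k ∈ principalLevelSubgroup C.δ C.N)
            (_hf : ∀ v w' : Fin C.g ⊕ Fin C.g → ℚ,
              AdelicCongr ((k * a₁⁻¹ : gspFinAdelic C.δ) : GL (Fin C.g ⊕ Fin C.g) finAdeleQ)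
                  ((r⁻¹ : gspFinAdelic C.δ) : GL (Fin C.g ⊕ Fin C.g) finAdeleQ) v w' →
                AlgPoints.map f.hom.hom.hom ((P.A.fibre s).toAbelianVariety.conjPoints σ.toRingEquiv (m₁.r v)) = m₂.r w'),
            ∀ b : 𝓞 F,
              haveI := ρ.isMonHom b
              haveI := (AbelianSchemeOver.serreAction ρ E' hE').isMonHom b
              AbelianVariety.Hom.conjugate σ.toRingEquiv (AbelianSchemeOver.fibreHom (ρ.i b) s) ≫ f =
                f ≫ AbelianSchemeOver.fibreHom ((AbelianSchemeOver.serreAction ρ E' hE').i b)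
                  (thickeningLift eE (S.M.obj Kc) ((S.pts Kc).symm (ShimuraSetGS.mk F Jstar ι₁ Kc.1.1 (fun i => ι₁ (w i)) hw a))).left
    := by
  intro F _ _ _ _ ι₁ Jstar hJ _hJu K₀ S _hU7 Kc Fi _ _ _ _ τE _hτE Φ hΦ C ξ k Fr hpin ε _hε ρ hR γ₁ 𝔞 n htw instC m E' hE' Pm Qm
    hP hQ hQP hPQ hspan Db hDb polB lvl' hex h5 eE heE w hw a
  letI iF : Algebra F ℂ := ι₁.toAlgebra
  letI iFi : Algebra Fi ℂ := τE.toAlgebra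
  haveI iE : NumberField ↥(reflexField F (flip ι₁ (bar (⟨Φ, hΦ.2⟩ : CMType F))) ι₁) :=
    numberField_reflexField F (flip ι₁ (bar (⟨Φ, hΦ.2⟩ : CMType F))) ι₁
  -- the junction rows and witnesses
  obtain ⟨hrow_a, _hrow_b, h𝔞, hj⟩ := htw
  obtain ⟨γ', hj⟩ := hj
  obtain ⟨sE, hj⟩ := hj
  obtain ⟨z, hj⟩ := hj
  obtain ⟨hγ'τ, hγ'F, hsE, hzs, hz𝔞, hcong⟩ := hj
  have hn : n ≠ 0 := by
    intro hn
    have h0 : 𝔞 * (IsCMField.complexConj F) • 𝔞 ≠ ⊥ :=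
      mul_ne_zero h𝔞 (Literature.NumberTheory.NumberFields.pointwise_smul_ne_bot (IsCMField.complexConj F) h𝔞)
    apply h0
    rw [← hrow_a, hn, Nat.cast_zero, Ideal.span_singleton_eq_bot]
  have hN0 : C.N ≠ 0 := by have := C.hN; omega
  -- ★ p850956 (B3-SRC) at this special sheet point
  have hsrc := exists_cmConjHom_at_specialSheetPoint hJ hΦ C hpin ε ρ hR γ₁ 𝔞 h𝔞 γ' hγ'τ hγ'F sE hsE z hzs hz𝔞 E' hE' Pm Qm hn
    hP hQ hQP hPQ hspan eE heE w hw a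
  obtain ⟨σ, hsrc⟩ := hsrc
  obtain ⟨hσF, hsrc⟩ := hsrc
  obtain ⟨hσγ, hsrc⟩ := hsrc
  obtain ⟨_hσeq, hsrc⟩ := hsrc
  obtain ⟨s, hsrc⟩ := hsrc
  obtain ⟨hs, hsrc⟩ := hsrc
  obtain ⟨d, hsrc⟩ := hsrc
  obtain ⟨hd, hsrc⟩ := hsrc
  obtain ⟨v₁, hsrc⟩ := hsrc
  obtain ⟨hv₁, hsrc⟩ := hsrc
  obtain ⟨a₁, hsrc⟩ := hsrc
  obtain ⟨m₁, hsrc⟩ := hsrc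
  obtain ⟨Θ₁, hsrc⟩ := hsrc
  obtain ⟨Λ₁, hsrc⟩ := hsrc
  obtain ⟨v₂, hsrc⟩ := hsrc
  obtain ⟨hv₂, hsrc⟩ := hsrc
  obtain ⟨a₂, hsrc⟩ := hsrc
  obtain ⟨m₀, hsrc⟩ := hsrc
  obtain ⟨Θ₂, hsrc⟩ := hsrc
  obtain ⟨Λ₂, hsrc⟩ := hsrc
  obtain ⟨Z₂, hsrc⟩ := hsrc
  obtain ⟨hZ₂, hsrc⟩ := hsrc
  obtain ⟨r₂, hsrc⟩ := hsrc
  obtain ⟨m₂, hsrc⟩ := hsrc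
  obtain ⟨q', hsrc⟩ := hsrc
  obtain ⟨qm, hsrc⟩ := hsrc
  obtain ⟨M₂, hsrc⟩ := hsrc
  obtain ⟨f, hsrc⟩ := hsrc
  obtain ⟨kk, hsrc⟩ := hsrc
  obtain ⟨_hcl₁, _hample₁, hlam₁, hlvl₁, -, -, -, -, _hcl₂, _hample₂, hlam₂, hlvl₂, -, -, -, -, hr₂, hq'eq, -, hq', -, -, hm₂,
    hk, hf, hint⟩ := hsrc
  -- ★ p850898 `hpt` (LA4-p04 (g4)): `ℓ_{eE}(z₀) ≫ gγ = Spec σ ≫ ℓ_{eE}(pts⁻¹[ι₁w, d⁻¹a])`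
  have hpt := S.thickeningLift_left_comp_gal_eq_specTwist_comp_of_recip' Kc eE γ₁ σ hσF hσγ s hs w hw d hd a
  -- ★ p850830 the tower at the principal representative (LA5-p02 (g4))
  haveI hc₀ : IsMonHom (AbelianSchemeOver.serreTranslate ρ E' hE' Pm) := AbelianSchemeOver.isMonHom_serreTranslate ρ E' hE' Pm
  haveI : IsCommMonObj (AbelianSchemeOver.serreTensor ρ E' hE').X := AbelianSchemeOver.isCommMonObj_serreTensor ρ E' hE'
  have hrows := AbelianSchemeOver.serreCover_rows_of_presentation ρ E' hE' Pm Qm hn hP hQ hQP hPQ hspan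
  obtain ⟨-, -, hsurj, -, -⟩ := hrows
  haveI : Surjective (AbelianSchemeOver.serreTranslate ρ E' hE' Pm).left := ⟨hsurj⟩
  have hex' := (AbelianSchemeOver.isExactTwistPol_iff ρ E' hE' Pm
    (C.𝓜.univ.baseChange (ε.left ≫ pullback.fst C.𝓜.M.hom (bcSpec ℚ Fi))).D Db
    (C.𝓜.univ.baseChange (ε.left ≫ pullback.fst C.𝓜.M.hom (bcSpec ℚ Fi))).pol n polB.lam).1 hex
  have hzT : z ∈ torusFinAdelic F :=
    hzs ▸ Literature.AlgebraicGeometry.ShimuraVarieties.UnitaryCanonicalModel.Aux.reflexNormFiniteIdele_mem_torusFinAdelic F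
      (flip ι₁ (bar (⟨Φ, hΦ.2⟩ : CMType F))) ι₁ sE
  have hqx := (Literature.AlgebraicGeometry.ShimuraVarieties.UnitaryCanonicalModel.Aux.mem_torusFinAdelic_iff F z).1 hzT
  obtain ⟨q, hq⟩ := hqx
  have htower := exists_isLambdaOfAt_symplecticLift_torusLeg_principal C.hδ C.hg Fr C.ρ₀ hpin.2.2.2 ⟨z, hzT⟩ 𝔞 h𝔞 hz𝔞 hn hrow_a hN0
    hcong q hq (AbelianSchemeOver.serreTranslate ρ E' hE' Pm)
    (C.𝓜.univ.baseChange (ε.left ≫ pullback.fst C.𝓜.M.hom (bcSpec ℚ Fi))).level lvl' h5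
    (C.𝓜.univ.baseChange (ε.left ≫ pullback.fst C.𝓜.M.hom (bcSpec ℚ Fi))).pol polB hex' (C.q_spec v₂ hv₂ a₂).2
    Θ₂ hlam₂ Λ₂ m₀ hlvl₂ qm q' hq'eq m₂ hq' hm₂
  obtain ⟨Θ₂', -, hΘ₂', Λ₂', hΛ₂'⟩ := htower
  exact ⟨σ, _, hpt, _, _, kk, Θ₁, hlam₁, Λ₁, m₁, hlvl₁, r₂, hr₂, Z₂, hZ₂, m₂, Θ₂', hΘ₂', Λ₂', hΛ₂', f, hk, hf, hint⟩

end Summit.HodgeConjecture.HodgeConjecture.Theorems.F0P6aOrganB3Src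

end
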